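import Mathlib
import HarnessLib

/-!
# Route SubcriticalEnvelope — objects posited by the LEAD's rung «uniform KP 2-cycles»
(definitions file for the crux `SubcriticalEnvelope.ForwardSourceTailEnvelopeKP`, item
stmt-NavierStokesRegularity-27130; D-0016: definitions a line needs are reviewed, never buried in a
proof file)

The KP-class cruxes of the TL-M2Break cluster (27057 `ForwardTailCeilingKP`, 27130
`ForwardSourceTailEnvelopeKP`, parked 26999 `KPBlockWake`) quantify over ALL orthant tables of
`E₂(R)` with diagonal inter-shell feeds.  Their landed rungs so far cover the ONE-MODE chain
`c·dyadicTable` (`dyadicRange_shellBarrierAt`, ε₀ ∈ [7/10,1]).  The simplest multi-mode KP-proper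
architecture — and a W5 instrument row (matrix 4, 2-cycles) — is the 2-CYCLE: two Katz–Pavlović
feeds `x_{0,k}² → x_{1,k+1}` (coefficient `c₀`) and `x_{1,k}² → x_{0,k+1}` (coefficient `c₁`).  With a
one-shell datum the 2-cycle lattice splits into two INTERLEAVED, dynamically decoupled chains
(«strands»): the drain partner of the mode `(j,k)` is `(j+1 mod 2, k+1)`, in the same strand.  The
objects below let the sibling proof file state that reduction:

* `kpTwoCycleTable c₀ c₁` — the 2-cycle table (feeds on the shift `(0,0,1)`, the Katz–Pavlović
  back-reactions `−c/2` on `(1,0,0)`/`(0,1,0)`; components `2`, `3` idle);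
* `cyclePhase r k ∈ Fin 4` — the component lit at shell `k` on the strand `r ∈ {0,1}`:
  `(k + r) mod 2`;
* `cycleStrand r X` — the strand `r` of a lattice trajectory `X`, re-dressed as a ONE-MODE family
  on component `0`: `(cycleStrand r X) 0 k t = X (cyclePhase r k) k t`, other components `0`.

HONEST FRAMING: MODEL-lattice objects in Tao's §4 vocabulary (rung TL-M2Break); nothing here is a
statement about the Navier–Stokes equations; no crux is proved or refuted by this file.
References for the vocabulary: [cite: Tao2016AveragedNS, §4 (4.2)–(4.3), (4.8)]; Katz–Pavlović pairs:
[cite: BarbatoMorandinRomito2011, §1 (1.1)].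
-/

noncomputable section

-- the sub-problem namespace `NavierStokesRegularity.NavierStokesRegularity` is the tree's layout (D-0017)
set_option linter.dupNamespace false

namespace Summit.NavierStokesRegularity.NavierStokesRegularity.Theorems

/-- THE KP 2-CYCLE TABLE with feed coefficients `c₀` (feed `x_{0,k}² → x_{1,k+1}`) and `c₁`
(feed `x_{1,k}² → x_{0,k+1}`): `α_{001,(0,0,1)} = c₀`, `α_{100,(1,0,0)} = α_{010,(0,1,0)} = −c₀/2`,
`α_{110,(0,0,1)} = c₁`, `α_{011,(1,0,0)} = α_{101,(0,1,0)} = −c₁/2`, all other entries `0`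
(components `2`, `3` idle).  Symmetric (4.2), cancelling (4.3), orthant (two Katz–Pavlović pairs with
diagonal feed forms `c₀w₀²`, `c₁w₁²`), KP proper.  MODEL-lattice object (Tao 2016 §4 vocabulary).
[this file; routes SubcriticalEnvelope / SubOnsagerCeiling / OrthantWake] -/
def kpTwoCycleTable (c₀ c₁ : ℝ) : Fin 4 → Fin 4 → Fin 4 → ℤ × ℤ × ℤ → ℝ := fun i₁ i₂ i₃ μ =>
  if μ = ((0 : ℤ), (0 : ℤ), (1 : ℤ)) then
    ((if i₁ = 0 ∧ i₂ = 0 ∧ i₃ = 1 then c₀ else 0) + (if i₁ = 1 ∧ i₂ = 1 ∧ i₃ = 0 then c₁ else 0))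
  else if μ = ((1 : ℤ), (0 : ℤ), (0 : ℤ)) then
    ((if i₁ = 1 ∧ i₂ = 0 ∧ i₃ = 0 then -(c₀ / 2) else 0) +
      (if i₁ = 0 ∧ i₂ = 1 ∧ i₃ = 1 then -(c₁ / 2) else 0))
  else if μ = ((0 : ℤ), (1 : ℤ), (0 : ℤ)) then
    ((if i₁ = 0 ∧ i₂ = 1 ∧ i₃ = 0 then -(c₀ / 2) else 0) +
      (if i₁ = 1 ∧ i₂ = 0 ∧ i₃ = 1 then -(c₁ / 2) else 0))
  else 0

/-- THE PHASE of strand `r` at shell `k`: the component `(k + r) mod 2 ∈ {0, 1} ⊂ Fin 4` that the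
strand occupies at shell `k` (strand `0` sits on component `0` at even shells and on component `1`
at odd shells; strand `1` the other way round). [this file] -/
def cyclePhase (r k : ℤ) : Fin 4 := if (k + r) % 2 = 0 then 0 else 1

/-- THE STRAND `r` of a lattice trajectory `X` of the 2-cycle, re-dressed as a one-mode family on
component `0`: `(cycleStrand r X) 0 k t = X (cyclePhase r k) k t` and `(cycleStrand r X) i k t = 0`
for `i ≠ 0`.  For the uniform 2-cycle (`c₀ = c₁ = c`) each strand solves the `c·dyadicTable` lattice
(sibling proof file). [this file] -/
def cycleStrand (r : ℤ) (X : Fin 4 → ℤ → ℝ → ℝ) : Fin 4 → ℤ → ℝ → ℝ :=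
  fun i k t => if i = 0 then X (cyclePhase r k) k t else 0

/-! ## KP permutation networks (LEAD-SE rung «uniform KP permutation networks», ns-senv-p1 g3)

The general KP-proper architecture with ONE Katz–Pavlović feed out of every component and at most one
feed into every component: a permutation `σ` of the four components and feeds `x_{a,k}² → x_{σ a,k+1}`
with coefficients `c a` (`c a = 0` = component `a` feeds nothing).  It subsumes the one-mode chain
(`σ = 1`, `c = c·e₀` gives `c·dyadicTable`), the 2-cycle (`σ = swap 0 1`, `c = (c₀, c₁, 0, 0)` gives
`kpTwoCycleTable c₀ c₁`), the 3- and 4-cycles and all products of disjoint cycles and parallel chains.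
With a one-shell datum its lattice splits into four dynamically decoupled STRANDS: the strand of
`a₀` occupies the component `(σ^k) a₀` at shell `k`, and the drain partner of a mode is the next mode
of the same strand.  When `c` is constant on the `σ`-orbit of `a₀` that strand is a `(c a₀)·dyadicTable`
chain (sibling proof files). -/

/-- THE KP PERMUTATION NETWORK with component permutation `σ` and feed coefficients `c`: for every
component `a` the Katz–Pavlović pair `x_{a,k}² → x_{σ a,k+1}` with coefficient `c a`, i.e.
`α_{a a (σ a),(0,0,1)} = c a`, `α_{(σ a) a a,(1,0,0)} = α_{a (σ a) a,(0,1,0)} = −(c a)/2`, all other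
entries `0`.  Symmetric (4.2), cancelling (4.3); orthant iff `c ≥ 0`; diagonal feed forms (KP proper).
MODEL-lattice object (Tao 2016 §4 vocabulary). [this file; routes SubcriticalEnvelope /
SubOnsagerCeiling / OrthantWake] -/
def kpPermTable (σ : Equiv.Perm (Fin 4)) (c : Fin 4 → ℝ) :
    Fin 4 → Fin 4 → Fin 4 → ℤ × ℤ × ℤ → ℝ := fun i₁ i₂ i₃ μ =>
  if μ = ((0 : ℤ), (0 : ℤ), (1 : ℤ)) then (if i₁ = i₂ ∧ i₃ = σ i₁ then c i₁ else 0)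
  else if μ = ((1 : ℤ), (0 : ℤ), (0 : ℤ)) then (if i₁ = σ i₂ ∧ i₃ = i₂ then -(c i₂ / 2) else 0)
  else if μ = ((0 : ℤ), (1 : ℤ), (0 : ℤ)) then (if i₂ = σ i₁ ∧ i₃ = i₁ then -(c i₁ / 2) else 0)
  else 0

/-- THE PHASE of the strand of `a₀` at shell `k` in the permutation network `σ`: the component
`(σ^k) a₀` (integer power, so that shell `k − 1` sits on `σ⁻¹` of the phase at `k`). [this file] -/
def permPhase (σ : Equiv.Perm (Fin 4)) (a₀ : Fin 4) (k : ℤ) : Fin 4 := (σ ^ k) a₀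

/-- THE STRAND of `a₀` of a lattice trajectory `X` of the permutation network `σ`, re-dressed as a
one-mode family on component `0`: `(permStrand σ a₀ X) 0 k t = X (permPhase σ a₀ k) k t` and
`(permStrand σ a₀ X) i k t = 0` for `i ≠ 0`. [this file] -/
def permStrand (σ : Equiv.Perm (Fin 4)) (a₀ : Fin 4) (X : Fin 4 → ℤ → ℝ → ℝ) :
    Fin 4 → ℤ → ℝ → ℝ :=
  fun i k t => if i = 0 then X (permPhase σ a₀ k) k t else 0

/-! ## KP fan networks (LEAD-SE rung «uniform KP fan networks», ns-senv-p1 g3)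

The simplest KP-proper architecture with BRANCHING AND MERGING feeds: every component feeds every
component one shell up, the target `i` receiving the fixed share `w i ≥ 0` from each source
(`x_{a,k}² → x_{i,k+1}` with coefficient `w i` for all `a`).  Its feed matrix is rank one; with a
one-shell datum the lattice collapses onto the profile `w` from shell `1` on (`x_{i,k} = w i · u_k`,
`u` a `|w|²·dyadicTable` chain), which is how the sibling proof file transfers the chain barrier. -/

/-- THE KP FAN NETWORK with target weights `w`: for all components `a, i` the Katz–Pavlović pair
`x_{a,k}² → x_{i,k+1}` with coefficient `w i`, i.e. `α_{a a i,(0,0,1)} = w i`,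
`α_{i a a,(1,0,0)} = α_{a i a,(0,1,0)} = −(w i)/2`, all other entries `0`.  Symmetric (4.2),
cancelling (4.3); orthant iff `w ≥ 0`; diagonal feed forms (KP proper).  MODEL-lattice object
(Tao 2016 §4 vocabulary). [this file; routes SubcriticalEnvelope / SubOnsagerCeiling / OrthantWake] -/
def kpFanTable (w : Fin 4 → ℝ) : Fin 4 → Fin 4 → Fin 4 → ℤ × ℤ × ℤ → ℝ := fun i₁ i₂ i₃ μ =>
  if μ = ((0 : ℤ), (0 : ℤ), (1 : ℤ)) then (if i₁ = i₂ then w i₃ else 0)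
  else if μ = ((1 : ℤ), (0 : ℤ), (0 : ℤ)) then (if i₂ = i₃ then -(w i₁ / 2) else 0)
  else if μ = ((0 : ℤ), (1 : ℤ), (0 : ℤ)) then (if i₁ = i₃ then -(w i₂ / 2) else 0)
  else 0

end Summit.NavierStokesRegularity.NavierStokesRegularity.Theorems

end
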